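import Literature.NumberTheory.Automorphic.UnramifiedOrbitSetNonsplit
import Literature.NumberTheory.Automorphic.CompactCoreLevel
import Literature.NumberTheory.GaloisRepresentations.StableLatticeValuationRing
import HarnessLib

/-!
# The compact core of a regular centraliser lies in the integral level at almost every place — the named fact
# `UnitaryGroup.CompactCoreCentralizerLevelAE` PROVED for hermitian non-degenerate `H`
(Kottwitz, *Stable trace formula: elliptic singular terms* (1986), Prop. 7.1; Tits, *Reductive groups over local fields* (1979), §3.9;
Serre, *Abelian ℓ-adic representations and elliptic curves* (1968), Ch. I §1.1, Remark 1; Rogawski (1990), §4.3 p. 43)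

Topic `NumberTheory/Automorphic`; namespaces `Literature.NumberTheory.Automorphic` (§1–§2, generic) and `….UnitaryGroup` (§3–§4); THEOREMS
ONLY (no definition, no instance, no named fact, no `sorry`).  DISCHARGES the named fact ★ `UnitaryGroup.CompactCoreCentralizerLevelAE L N H`
(`Automorphic/CompactCoreLevel`: «for a regular rational `γ`, `compactCore Z(γ_v) ⊆ K_v` for almost every `v`», the input of the (viii′-3)
normalisation ★ `exists_isNormalisedOff_of_isCanonical`) for every HERMITIAN `H` with `det H ≠ 0` — `compactCoreCentralizerLevelAE_of_hermitian` —
from the INTEGRAL CONJUGACY of regular matrices (★ `IntegralConjugacyOfRegularElements`, the `GL_N` orbit lemma over the local ring `𝒪_w`) and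
Serre's «compact groups of matrices stabilise a lattice» (★ `exists_conj_mem_range_generalLinearGroup_map_of_valuationSubring`), WITHOUT the
unitary upgrade:

THE ARGUMENT (at a place `w ∣ v` where `γ_w ∈ GL_N(𝒪_w)` and `p_γ` is separable modulo `𝔪_w` — almost every `v`).  Let `C ≤ U(J)(F_v)` be a
compact subgroup centralising `γ_v`, read in `GL_N(E_w)` through the one-place model (split ★ `localSplitEquiv` or not ★ `localNonsplitEquiv`).
The centraliser `Z = Z_{GL_N(E_w)}(γ ⊗ 1)` is COMMUTATIVE (`p_γ` separable, ★ `commute_of_commute_map_of_charpoly_separable`), so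
`D = C · (GL_N(𝒪_w) ∩ Z)` is a compact subgroup; by Serre there is `P` with `P⁻¹ D P ⊆ GL_N(𝒪_w)`, in particular `P⁻¹ (γ ⊗ 1) P ∈ GL_N(𝒪_w)`,
so by the orbit lemma ★ `mem_range_map_mul_centralizer_of_conj_mem_range` `P⁻¹ = k z` with `k ∈ GL_N(𝒪_w)`, `z ∈ Z`; for `c ∈ C ⊆ Z`:
`P⁻¹ c P = k z c z⁻¹ k⁻¹ = k c k⁻¹ ∈ GL_N(𝒪_w)`, hence `c ∈ GL_N(𝒪_w)`, i.e. `C ⊆ K_v` (★ `mem_localIntegralLevel_iff_of_ne` ∕ `_of_smul_eq`).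
«`T(𝒪_v) = T(F_v) ∩ K_v` is the maximal compact subgroup of the torus `T = G_γ` at the good places» [Tits1979, §3.9; Rogawski1990, §4.3 p. 43].

* §1 (`E` a number field, `w` a finite place, `γ ∈ GL_N(E)` with separable characteristic polynomial, `γ_w ∈ GL_N(𝒪_w)`, separable integral
  model): **`subgroup_le_glInt_of_isCompact_of_le_centralizer`** — every compact subgroup of `GL_N(E_w)` centralising `γ ⊗ 1` lies in `GL_N(𝒪_w)`.
* §2 (any topological group `G` with a continuous homomorphism `φ : G →* GL_N(E_w)` and a level `K = φ⁻¹(GL_N(𝒪_w))`):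
  `compactCore_centralizer_subset_of_hom` — `compactCore Z_G(g₀) ⊆ K` as soon as §1 holds at `φ g₀`.
* §3 (generic `E/F`, `c`, `J` hermitian with `det J` a unit; `γ ∈ GL_N(E)` separable with `γ ⊗ 1 ∈ U(J)(F_v)` for all `v`):
  **`eventually_compactCore_centralizer_subset`** — `∀ᶠ v, compactCore Z(γ_v) ⊆ U(J)(𝒪_v)` (split places through ★ `localSplitEquiv`, the others
  through ★ `localNonsplitEquiv`).
* §4 CM: **`compactCoreCentralizerLevelAE_of_hermitian (hH) (hHd) : CompactCoreCentralizerLevelAE L N H`** — the named fact is a THEOREM for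
  hermitian `H` with `det H ≠ 0` (debt −1 at every consumer: the kit's `H` and `Φ₃` are hermitian non-degenerate).

## References
* R. E. Kottwitz, *Stable trace formula: elliptic singular terms*, Math. Ann. 275 (1986), §7, Prop. 7.1 [Kottwitz1986].
* J. Tits, *Reductive groups over local fields*, Proc. Sympos. Pure Math. 33.1 (1979), §3.9 [Tits1979].
* J.-P. Serre, *Abelian ℓ-adic representations and elliptic curves*, Benjamin (1968), Ch. I §1.1, Remark 1 [SerreAbelianLadic1968].
* J. D. Rogawski, *Automorphic Representations of Unitary Groups in Three Variables*, Ann. of Math. Stud. 123 (1990), §4.3 p. 43 [Rogawski1990].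
-/

set_option autoImplicit false

noncomputable section

open NumberField IsDedekindDomain Filter Polynomial
open scoped Matrix Pointwise

namespace Literature.NumberTheory.Automorphic

/-! ## §1 Compact subgroups of `GL_N(E_w)` centralising an integral regular semisimple element are integral -/

section LocalGL

variable {E : Type} [Field E] [NumberField E] (N : ℕ)

/-- A subgroup whose carrier is the product `C · K′` of two subgroups whose elements commute pairwise. [cite: BourbakiGT1, Ch. III §2] -/
theorem exists_subgroup_coe_eq_mul_of_forall_commute {G : Type*} [Group G] (C K' : Subgroup G)
    (hcomm : ∀ a ∈ C, ∀ b ∈ K', a * b = b * a) : ∃ D : Subgroup G, (D : Set G) = (C : Set G) * (K' : Set G) := by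
  refine ⟨{ carrier := (C : Set G) * (K' : Set G), mul_mem' := ?_, one_mem' := ⟨1, C.one_mem, 1, K'.one_mem, mul_one 1⟩, inv_mem' := ?_ }, rfl⟩
  · rintro _ _ ⟨a, ha, b, hb, rfl⟩ ⟨a', ha', b', hb', rfl⟩
    refine ⟨a * a', C.mul_mem ha ha', b * b', K'.mul_mem hb hb', ?_⟩
    calc a * a' * (b * b') = a * (a' * b) * b' := by simp only [mul_assoc]
      _ = a * (b * a') * b' := by rw [hcomm a' ha' b hb]
      _ = a * b * (a' * b') := by simp only [mul_assoc]
  · rintro _ ⟨a, ha, b, hb, rfl⟩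
    refine ⟨a⁻¹, C.inv_mem ha, b⁻¹, K'.inv_mem hb, ?_⟩
    rw [mul_inv_rev, ← hcomm a⁻¹ (C.inv_mem ha) b⁻¹ (K'.inv_mem hb)]

/-- **Compact subgroups of `GL_N(E_w)` centralising an integral regular semisimple `γ ⊗ 1` are integral.**  For `γ ∈ GL_N(E)` with separable
characteristic polynomial, `γ_w ∈ GL_N(𝒪_w)` (★ `glInt`) and an integral model of `p_γ` separable modulo `𝔪_w`: every compact subgroup
`C ≤ GL_N(E_w)` centralising `γ ⊗ 1` is contained in `GL_N(𝒪_w)` — Serre's stable lattice for the compact commutative group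
`C · (GL_N(𝒪_w) ∩ Z(γ ⊗ 1))` (★ `exists_conj_mem_range_generalLinearGroup_map_of_valuationSubring`), the `GL_N` orbit lemma over `𝒪_w`
(★ `mem_range_map_mul_centralizer_of_conj_mem_range`) and the commutativity of `Z(γ ⊗ 1)` (★ `commute_of_commute_map_of_charpoly_separable`).
[cite: SerreAbelianLadic1968, Ch. I §1.1, Remark 1] [cite: Kottwitz1986, Prop. 7.1] [cite: Tits1979, §3.9] -/
theorem subgroup_le_glInt_of_isCompact_of_le_centralizer (w : HeightOneSpectrum (𝓞 E)) (γ : GL (Fin N) E)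
    (hγ : ((γ : Matrix (Fin N) (Fin N) E).charpoly).Separable)
    (hγint : Matrix.GeneralLinearGroup.map (algebraMap E (w.adicCompletion E)) γ ∈ glInt N (w.adicCompletion E))
    (hsep : ∃ q : (w.adicCompletionIntegers E)[X],
      q.map (w.adicCompletionIntegers E).subtype = (γ : Matrix (Fin N) (Fin N) E).charpoly.map (algebraMap E (w.adicCompletion E)) ∧
        (q.map (IsLocalRing.residue (w.adicCompletionIntegers E))).Separable)
    (C : Subgroup (GL (Fin N) (w.adicCompletion E))) (hC : IsCompact (C : Set (GL (Fin N) (w.adicCompletion E))))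
    (hCZ : C ≤ Subgroup.centralizer
      ({Matrix.GeneralLinearGroup.map (algebraMap E (w.adicCompletion E)) γ} : Set (GL (Fin N) (w.adicCompletion E)))) :
    C ≤ glInt N (w.adicCompletion E) := by
  -- notation-free abbreviations
  obtain ⟨γw, hγw⟩ : ∃ γw : GL (Fin N) (w.adicCompletion E), γw = Matrix.GeneralLinearGroup.map (algebraMap E (w.adicCompletion E)) γ :=
    ⟨_, rfl⟩
  rw [← hγw] at hγint hCZ
  -- the centraliser of `γ ⊗ 1` in `GL_N(E_w)` is commutative
  have hcommZ : ∀ a b : GL (Fin N) (w.adicCompletion E),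
      a ∈ Subgroup.centralizer ({γw} : Set (GL (Fin N) (w.adicCompletion E))) →
      b ∈ Subgroup.centralizer ({γw} : Set (GL (Fin N) (w.adicCompletion E))) → a * b = b * a := by
    intro a b ha hb
    rw [Subgroup.mem_centralizer_singleton_iff] at ha hb
    have ha' : Commute ((γ : Matrix (Fin N) (Fin N) E).map (algebraMap E (w.adicCompletion E))) (a : Matrix (Fin N) (Fin N) (w.adicCompletion E)) := by
      have h := congrArg (fun u : GL (Fin N) (w.adicCompletion E) => (u : Matrix (Fin N) (Fin N) (w.adicCompletion E))) ha
      simp only [Units.val_mul, hγw] at h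
      exact h.symm
    have hb' : Commute ((γ : Matrix (Fin N) (Fin N) E).map (algebraMap E (w.adicCompletion E))) (b : Matrix (Fin N) (Fin N) (w.adicCompletion E)) := by
      have h := congrArg (fun u : GL (Fin N) (w.adicCompletion E) => (u : Matrix (Fin N) (Fin N) (w.adicCompletion E))) hb
      simp only [Units.val_mul, hγw] at h
      exact h.symm
    exact Units.ext (Literature.LinearAlgebra.Matrix.commute_of_commute_map_of_charpoly_separable (K := E)
      (R := w.adicCompletion E) (γ : Matrix (Fin N) (Fin N) E) hγ ha' hb').eq
  -- `K′ = GL_N(𝒪_w) ∩ Z(γ ⊗ 1)`, compact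
  haveI : CharZero (w.adicCompletion E) := charZero_of_injective_algebraMap (algebraMap E _).injective
  have hK'c : IsCompact ((glInt N (w.adicCompletion E) ⊓ Subgroup.centralizer ({γw} : Set (GL (Fin N) (w.adicCompletion E))) :
      Subgroup (GL (Fin N) (w.adicCompletion E))) : Set (GL (Fin N) (w.adicCompletion E))) := by
    rw [Subgroup.coe_inf]
    exact (isCompact_glInt N (w.adicCompletion E)).inter_right (Set.isClosed_centralizer _)
  -- `D = C · K′`, a compact subgroup
  obtain ⟨D, hD⟩ := exists_subgroup_coe_eq_mul_of_forall_commute C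
    (glInt N (w.adicCompletion E) ⊓ Subgroup.centralizer ({γw} : Set (GL (Fin N) (w.adicCompletion E))))
    (fun a ha b hb => hcommZ a b (hCZ ha) (Subgroup.mem_inf.1 hb).2)
  have hDc : IsCompact (D : Set (GL (Fin N) (w.adicCompletion E))) := by
    rw [hD]; exact hC.mul hK'c
  haveI : CompactSpace D := isCompact_iff_compactSpace.1 hDc
  -- Serre: `P⁻¹ D P ⊆ GL_N(𝒪_w)`
  obtain ⟨P, hP⟩ := Literature.NumberTheory.GaloisRepresentations.exists_conj_mem_range_generalLinearGroup_map_of_valuationSubring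
    (O := w.adicCompletionIntegers E) (Valued.isOpen_valuationSubring (w.adicCompletion E))
    ({ D.subtype with continuous_toFun := continuous_subtype_val } : D →ₜ* GL (Fin N) (w.adicCompletion E))
  have hP' : ∀ d : GL (Fin N) (w.adicCompletion E), d ∈ D →
      P⁻¹ * d * P ∈ glInt N (w.adicCompletion E) := fun d hd =>
    (mem_range_map_adicCompletionIntegers_iff_mem_glInt N w _).1 (hP ⟨d, hd⟩)
  have hmemD : ∀ {d : GL (Fin N) (w.adicCompletion E)}, d ∈ (C : Set (GL (Fin N) (w.adicCompletion E))) *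
      ((glInt N (w.adicCompletion E) ⊓ Subgroup.centralizer ({γw} : Set (GL (Fin N) (w.adicCompletion E))) :
        Subgroup (GL (Fin N) (w.adicCompletion E))) : Set (GL (Fin N) (w.adicCompletion E))) → d ∈ D := fun hd => by
    rw [← SetLike.mem_coe, hD]; exact hd
  -- `γ ⊗ 1 ∈ D`, so `P⁻¹ (γ ⊗ 1) P ∈ GL_N(𝒪_w)`
  have hγD : γw ∈ D := hmemD ⟨1, C.one_mem, γw, Subgroup.mem_inf.2 ⟨hγint, Subgroup.mem_centralizer_singleton_iff.2 rfl⟩, one_mul _⟩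
  -- the integral lift of `γ ⊗ 1` and its separable reduction
  obtain ⟨γO, hγO⟩ := (mem_range_map_adicCompletionIntegers_iff_mem_glInt N w _).2 hγint
  obtain ⟨q, hq, hqsep⟩ := hsep
  have hchar : (γO : Matrix (Fin N) (Fin N) (w.adicCompletionIntegers E)).charpoly = q := by
    apply Polynomial.map_injective (w.adicCompletionIntegers E).subtype Subtype.val_injective
    rw [hq, ← Matrix.charpoly_map, ← Matrix.charpoly_map]
    congr 1
    have h := congrArg (fun u : GL (Fin N) (w.adicCompletion E) => (u : Matrix (Fin N) (Fin N) (w.adicCompletion E))) hγO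
    rw [hγw] at h
    exact h
  have hsep' : ((γO : Matrix (Fin N) (Fin N) (w.adicCompletionIntegers E)).charpoly.map
      (IsLocalRing.residue (w.adicCompletionIntegers E))).Separable := by
    rw [hchar]; exact hqsep
  -- the orbit lemma: `P⁻¹ = k z`, `k ∈ GL_N(𝒪_w)`, `z ∈ Z(γ ⊗ 1)`
  have hconj : P⁻¹ * Matrix.GeneralLinearGroup.map (w.adicCompletionIntegers E).subtype γO * P⁻¹⁻¹ ∈
      (Matrix.GeneralLinearGroup.map (n := Fin N) (w.adicCompletionIntegers E).subtype).range := by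
    rw [inv_inv, hγO]
    exact (mem_range_map_adicCompletionIntegers_iff_mem_glInt N w _).2 (hP' γw hγD)
  obtain ⟨k, hk, z, hz, hkz⟩ := Set.mem_mul.1
    (Literature.LinearAlgebra.Matrix.mem_range_map_mul_centralizer_of_conj_mem_range (w.adicCompletionIntegers E).subtype
      Subtype.val_injective γO hsep' P⁻¹ hconj)
  rw [hγO] at hz
  -- conclusion
  intro c hc
  have hcZ : c ∈ Subgroup.centralizer ({γw} : Set (GL (Fin N) (w.adicCompletion E))) := hCZ hc
  have hcD : c ∈ D := hmemD ⟨c, hc, 1, Subgroup.one_mem _, mul_one c⟩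
  have h1 : P⁻¹ * c * P ∈ glInt N (w.adicCompletion E) := hP' c hcD
  have hPeq : P = z⁻¹ * k⁻¹ := by rw [← mul_inv_rev, hkz, inv_inv]
  have h2 : P⁻¹ * c * P = k * c * k⁻¹ := by
    rw [← hkz, hPeq]
    calc k * z * c * (z⁻¹ * k⁻¹) = k * (z * c) * z⁻¹ * k⁻¹ := by simp only [mul_assoc]
      _ = k * (c * z) * z⁻¹ * k⁻¹ := by rw [hcommZ z c hz hcZ]
      _ = k * c * k⁻¹ := by rw [← mul_assoc k c z, mul_assoc (k * c) z z⁻¹, mul_inv_cancel, mul_one]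
  have hk' : k ∈ glInt N (w.adicCompletion E) := (mem_range_map_adicCompletionIntegers_iff_mem_glInt N w _).1 hk
  have h3 : c = k⁻¹ * (P⁻¹ * c * P) * k := by
    rw [h2]; group
  rw [h3]
  exact Subgroup.mul_mem _ (Subgroup.mul_mem _ (Subgroup.inv_mem _ hk') h1) hk'

end LocalGL

/-! ## §2 From `GL_N(E_w)` back to any group with a level `K = φ⁻¹(GL_N(𝒪_w))` -/

section Transport

variable {E : Type} [Field E] [NumberField E] (N : ℕ) (w : HeightOneSpectrum (𝓞 E))
  {G : Type*} [Group G] [TopologicalSpace G]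

/-- **`compactCore Z_G(g₀) ⊆ K`** for a continuous homomorphism `φ : G →* GL_N(E_w)` with `K = φ⁻¹(GL_N(𝒪_w))`, as soon as every compact subgroup of
`GL_N(E_w)` centralising `φ g₀` is integral (§1): a compact subgroup of `Z_G(g₀)` maps to a compact subgroup of `Z(φ g₀)`.
[cite: Tits1979, §3.9] [cite: BourbakiGT1, Ch. III §2] -/
theorem compactCore_centralizer_subset_of_hom (φ : G →* GL (Fin N) (w.adicCompletion E)) (hφ : Continuous φ) (K : Subgroup G)
    (hK : ∀ g, g ∈ K ↔ φ g ∈ glInt N (w.adicCompletion E)) (g₀ : G) (γw : GL (Fin N) (w.adicCompletion E)) (hγw : φ g₀ = γw)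
    (hint : ∀ C : Subgroup (GL (Fin N) (w.adicCompletion E)), IsCompact (C : Set (GL (Fin N) (w.adicCompletion E))) →
      C ≤ Subgroup.centralizer ({γw} : Set (GL (Fin N) (w.adicCompletion E))) → C ≤ glInt N (w.adicCompletion E)) :
    compactCore (Subgroup.centralizer ({g₀} : Set G)) ⊆ Subtype.val ⁻¹' (K : Set G) := by
  intro x hx
  obtain ⟨K₀, hK₀, hxK₀⟩ := (mem_compactCore_iff x).1 hx
  let C : Subgroup (GL (Fin N) (w.adicCompletion E)) := K₀.map (φ.comp (Subgroup.centralizer ({g₀} : Set G)).subtype)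
  have hCc : IsCompact (C : Set (GL (Fin N) (w.adicCompletion E))) := hK₀.image (hφ.comp continuous_subtype_val)
  have hCZ : C ≤ Subgroup.centralizer ({γw} : Set (GL (Fin N) (w.adicCompletion E))) := by
    rintro _ ⟨z, -, rfl⟩
    rw [Subgroup.mem_centralizer_singleton_iff, ← hγw, MonoidHom.comp_apply, Subgroup.coe_subtype, ← map_mul, ← map_mul,
      Subgroup.mem_centralizer_singleton_iff.1 z.2]
  have hxC : φ (x : G) ∈ C := ⟨x, hxK₀, rfl⟩
  exact (hK _).2 (hint C hCc hCZ hxC)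

end Transport

/-! ## §3 Almost every place: `compactCore Z(γ_v) ⊆ U(J)(𝒪_v)` -/

namespace UnitaryGroup

section Generic

variable {F E : Type} [Field F] [NumberField F] [Field E] [NumberField E] [Algebra F E]
  (c : E ≃ₐ[F] E) (N : ℕ) (J : Matrix (Fin N) (Fin N) E)

variable [Algebra.IsQuadraticExtension F E]

/-- **`compactCore Z(γ_v) ⊆ U(J)(𝒪_v)` for almost every `v`.**  For `c ≠ 1`, `J` `c`-hermitian with `det J` a unit, and `γ ∈ GL_N(E)` with
separable characteristic polynomial such that `γ ⊗ 1 ∈ U(J)(F_v)` for every `v` (elements `g v`): for all but finitely many `v` (off the places with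
`J_w ∉ GL_N(𝒪_w)`, `γ_w ∉ GL_N(𝒪_w)`, or no separable integral model of `p_γ`), every compact subgroup of the centraliser of `g v` in `U(J)(F_v)` lies in
`U(J)(𝒪_v)` — read in `GL_N(E_w)` through ★ `localSplitEquiv` at a split `w ∣ v` and through ★ `localNonsplitEquiv` at a non-split one, then §1–§2.
[cite: Tits1979, §3.9] [cite: Kottwitz1986, Prop. 7.1] [cite: Rogawski1990, §4.3 p. 43] -/
theorem eventually_compactCore_centralizer_subset (hc : c ≠ 1) (hJh : (J.map c)ᵀ = J) (hJ : IsUnit J.det) (γ : GL (Fin N) E)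
    (hγ : ((γ : Matrix (Fin N) (Fin N) E).charpoly).Separable) (g : ∀ v : HeightOneSpectrum (𝓞 F), «local» E c N J v)
    (hg : ∀ v, (g v : GL (Fin N) (LocalRing E v)) = toLocalGL E v γ) :
    ∀ᶠ v : HeightOneSpectrum (𝓞 F) in cofinite,
      compactCore (Subgroup.centralizer ({g v} : Set («local» E c N J v))) ⊆ Subtype.val ⁻¹' (localIntegralLevel c N J v : Set («local» E c N J v)) := by
  have hJu : IsUnit J := (Matrix.isUnit_iff_isUnit_det J).2 hJ
  filter_upwards [eventually_forall_unit_placeForm_mem_glInt (F := F) N J hJu, eventually_forall_map_mem_glInt F E γ,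
    eventually_forall_placesOver E (eventually_exists_separable_lift ((γ : Matrix (Fin N) (Fin N) E).charpoly) hγ)] with v hint hγint hsep
  obtain ⟨w⟩ := (inferInstance : Nonempty (PlacesOver E v))
  have h1 := subgroup_le_glInt_of_isCompact_of_le_centralizer N w.1 γ hγ (hγint w) ((hsep w).imp fun q hq => ⟨hq.1, hq.2.map⟩)
  by_cases hw : c • w.1 = w.1
  · -- non-split: through the one-place model `U(σ_w, J_w)(E_w) ≤ GL_N(E_w)`
    exact compactCore_centralizer_subset_of_hom N w.1
      ((unitaryGroupOfForm (galAdicCompletionMap (L := E) c hw) (placeForm J w.1)).subtype.comp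
        (localNonsplitEquiv c J hc w hw).toMulEquiv.toMonoidHom)
      (continuous_subtype_val.comp (localNonsplitEquiv c J hc w hw).continuous) (localIntegralLevel c N J v)
      (fun g' => mem_localIntegralLevel_iff_of_smul_eq c N J hc w hw g') (g v) _
      (localNonsplitEquiv_eq_map_of_eq_toLocalGL c N J hc w hw γ (g v) (hg v)) h1
  · -- split: through `U(J)(F_v) ≃ GL_N(E_w)`
    exact compactCore_centralizer_subset_of_hom N w.1 (localSplitEquiv c J hc hJh w hw (isUnit_placeForm J hJu w.1)).toMulEquiv.toMonoidHom
      (localSplitEquiv c J hc hJh w hw (isUnit_placeForm J hJu w.1)).continuous (localIntegralLevel c N J v)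
      (fun g' => mem_localIntegralLevel_iff_of_ne c N J hc hJh w hw (isUnit_placeForm J hJu w.1) (hint w) g') (g v) _
      (localSplitEquiv_eq_map_of_eq_toLocalGL c N J hc hJh w hw (isUnit_placeForm J hJu w.1) γ (g v) (hg v)) h1

end Generic

/-! ## §4 The CM dress: the named fact `CompactCoreCentralizerLevelAE L N H` is a theorem for hermitian non-degenerate `H` -/

section CM

variable (L : Type) [Field L] [NumberField L] [IsCMField L] (N : ℕ) (H : Matrix (Fin N) (Fin N) L)

/-- **`CompactCoreCentralizerLevelAE L N H` HOLDS for every hermitian `H` with `det H ≠ 0`**: for every regular semisimple rational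
`γ ∈ U(H)(L⁺)`, for all but finitely many finite places `v` of `L⁺`, the compact core of the centraliser of `γ_v` in `U(H)(L⁺_v)` lies in the
integral level `K_v = U(H)(𝒪_v)` (§3 at the diagonal image of `γ`, ★ `coe_cmDatum_toLocal_toAdelic`).  Discharges the named fact of ★
`Automorphic/CompactCoreLevel` at the kit's hermitian forms. [cite: Tits1979, §3.9] [cite: Rogawski1990, §4.3 p. 43] [cite: Kottwitz1986, Prop. 7.1] -/
theorem compactCoreCentralizerLevelAE_of_hermitian (hH : (H.map (cmConjRingHom L))ᵀ = H) (hHd : H.det ≠ 0) :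
    CompactCoreCentralizerLevelAE L N H := by
  intro γ hγ
  exact eventually_compactCore_centralizer_subset (IsCMField.complexConj L) N H (IsCMField.complexConj_ne_one L) hH
    (isUnit_iff_ne_zero.2 hHd) (γ.val : GL (Fin N) L) hγ (fun v => (cmDatum L N H).toLocal v ((cmDatum L N H).toAdelic γ))
    (fun v => coe_cmDatum_toLocal_toAdelic L N H v γ)

end CM

end UnitaryGroup

end Literature.NumberTheory.Automorphic

end
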